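import Summits.HodgeConjecture.HodgeConjecture.Theorems.Ring2AbelianAllWeilBaseChangeAlongProduct
import HarnessLib

/-!
# Ring 2 · AbelianAll (ab-weil-1, gen 140, part BCA-c) — LEMMA BC ALONG `K(√a)`: base change of Weil type
  from `K = ℚ(√-d)` to `E = K(√a)` for every non-square `a`, and the slice
  «R3 at ONE quartic `P_{d,a}` ⟹ Weil's question for `ℚ(√-d)`»

research route conditional on HC_CM; not a corollary; Q11.4-sentence-2 already refuted in dim ≥ 3.
`HC_CM` (`Theses.RankFourFaces.CMAbelianHodge`) does not occur in this file and NO open case of the Hodge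
conjecture is claimed: every algebraicity statement below carries the slice `WeilClassesCMFieldAt P` of rung R3
(`WeilTypeLadder.WeilClassesCMField`, Weil-type Hodge classes for CM fields of degree `> 2` — OPEN) as an
explicit hypothesis. Bears on H2 → H1 of the WEIL-1 brief (memo `run/shared/lean/pub/vhodge/memos/ROUTE-P2-g3.md`
§2.2 «one biquadratic field per imaginary quadratic field», §4 LEMMA BC).

## What is proved (0 sorry)

Gen 139 proved LEMMA BC with the ONE auxiliary real quadratic field `ℚ(√2)` (`E = K(√2)`,
`Ring2AbelianAllWeilBaseChangeRestriction.weilBaseChangeRestriction_holds`); parts BCA-a/b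
(`Ring2AbelianAllWeilBaseChangeAlongQuartic/AlongProduct.lean`) run the same kernel argument ALONG `K(√a)` for an
arbitrary `a` (`θ_a = (φ × φ) + S_a` on `B = A × A`, `P_{d,a}(θ_a) = 0`, the lift `L_r` with weights `a^{j/2}[j even]`
carries `weilClassesOf A φ n d` into `weilClassesField (A × A) θ_a P_{d,a} (2n)`, rationally, of type `(n,n)`,
`i^* ∘ L_r = id`). This file records the POINTED statements of the memo Sketch (`ROUTE-P2-g3-Sketch.lean` §2′,
vendored verbatim: `WeilClassesCMFieldAt`, `WeilClassesImaginaryQuadraticAt`, `WeilBaseChangeRestrictionAt`) and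
proves:

* `weilBaseChangeRestrictionAt_bcQuarticAlong : 0 < d → WeilBaseChangeRestrictionAt d (P_{d,a})` (every `a`;
  `P_{d,a}` is a CM quartic iff `a` is a non-square, `isCMQuartic_bcQuarticAlong`) — LEMMA BC at the FIXED pair
  `(d, P_{d,a})`: the single CM quartic field `E = ℚ(√-d, √a)` receives, by base change, every `ℚ(√-d)`-Weil
  datum of every dimension `2n` and EVERY discriminant;
* `weilClassesImaginaryQuadraticAt_of_weilClassesCMFieldAt_along : 0 < d → WeilClassesCMFieldAt (P_{d,a}) →
  WeilClassesImaginaryQuadraticAt d` — **Weil's 1977 question for `K = ℚ(√-d)` (all `n ≥ 2`, all discriminants)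
  follows from the Weil-type Hodge classes of the ONE quartic CM field `K(√a)`**, for each non-square `a`
  separately (for non-square `a` the hypothesis is a slice of R3: `weilClassesCMFieldAt_of_weilClassesCMField`);
  in particular (`weilClassesImaginaryQuadraticAt_one_of_zeta12`,
  `…_three_of_zeta12`, `…_one_of_zeta8`, `…_two_of_zeta8`) the cyclotomic fields `ℚ(ζ₁₂) = ℚ(i, √3) = ℚ(√-3, √3)`
  and `ℚ(ζ₈) = ℚ(i, √2) = ℚ(√-2, √2)` carry Weil's question for `ℚ(i)`, `ℚ(√-3)` resp. `ℚ(i)`, `ℚ(√-2)`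
  (presentations `P_{1,3} = T⁴ − 4T² + 16` with root `2ζ₁₂`, `P_{3,3} = T⁴ + 36`, `P_{1,2}`, `P_{2,2} = T⁴ + 16`
  with root `2ζ₈`);
* bookkeeping: `weilClassesCMFieldAt_of_weilClassesCMField` (the slice IS a specialisation of R3 at a CM quartic,
  `isCMQuartic_bcQuarticAlong`), `weilClassesImaginaryQuadratic_iff_forall_at` (R∞ = the conjunction of its
  `d`-slices), hence a second proof of gen 139's `R3 ⟹ R∞` through any fixed non-square `a`
  (`weilClassesImaginaryQuadratic_of_weilClassesCMField_along`).

Why the parameter matters (memo §4.3, not formalised here): for `a := δ = disc`, the base change `E = K(√δ)` is the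
one under which the `E`-Hermitian form of `B = A ⊗_K E` becomes SPLIT (`δ = Nm_{E/K} √δ` up to squares), i.e.
the reduction «every discriminant ⟸ split discriminant one CM degree up» (LEMMA HYP) runs along exactly these maps.

What is NOT claimed: R3 or any slice of it; LEMMA HYP; any `IsWeilTypeCM` / `HasWeilDiscriminantCM` placement of
`(A × A, θ_a)`; no Literature fact is introduced and no internally-minted statement is cited as a fact.

## References

* [Weil1977HodgeAV] A. Weil, Abelian varieties and the Hodge ring, Œuvres III [1977c], 421–429.
* [vanGeemen1994HodgeAV] B. van Geemen, An introduction to the Hodge conjecture for abelian varieties,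
  LNM 1594 (1994), 4.8–4.12, 6.12.
* [MoonenZarhin1998WeilClasses] B. Moonen, Yu. Zarhin, Weil classes on abelian varieties,
  J. reine angew. Math. 496 (1998), §1.
* [Deligne1982HodgeCycles] P. Deligne, Hodge cycles on abelian varieties, LNM 900 (1982), §4–§5.
-/

noncomputable section

set_option linter.dupNamespace false

open CategoryTheory
open scoped BigOperators
open Literature.AlgebraicGeometry Literature.AlgebraicGeometry.Motives
open Literature.AlgebraicGeometry.HodgeTheory
open Literature.AlgebraicTopology.SingularHomology
open Summit.HodgeConjecture.HodgeConjecture.WeilTypeLadder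

namespace Summit.HodgeConjecture.HodgeConjecture.Ring2.AbelianAll

variable {A : AbelianVariety ℂ} {d : ℕ}

/-! ### §4 The pointed statements (verbatim from `ROUTE-P2-g3-Sketch.lean` §2′) and LEMMA BC at `(d, P_{d,a})` -/

section Statement

/-- Rung R3 CONFINED to one quartic `P` (intended `P = P_{d,a}`): every rational `(m,m)` Weil class relative to
`E = ℚ[T]/(P)` on every abelian `4m`… (`4·2m = 2·dim`) …-fold carrying `θ` with `P(θ) = 0` is algebraic. -/
def WeilClassesCMFieldAt (P : Polynomial ℤ) : Prop :=
  ∀ (B : AbelianVariety ℂ) (θ : B ⟶ B) (m : ℕ),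
    Polynomial.eval₂ (Int.castRingHom (CategoryTheory.End B)) (θ : CategoryTheory.End B) P = 0 →
    4 * (2 * m) = 2 * B.dim →
      ∀ c ∈ weilClassesField B θ P (2 * m), IsRationalClass c →
        IsOfHodgeType B.dim B.X (2 * m) m m c → c ∈ algebraicClasses B.X m

/-- The slice is a specialisation of R3 at a CM quartic. -/
theorem weilClassesCMFieldAt_of_weilClassesCMField {P : Polynomial ℤ} (hP : IsCMQuartic P)
    (h₃ : WeilClassesCMField) : WeilClassesCMFieldAt P := by
  obtain ⟨hmon, hdeg, hirr, hreal, hconj⟩ := hP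
  intro B θ m hθ hdim c hcW hcrat hcH
  exact h₃ B θ P 4 m hmon hdeg (by norm_num) hirr hθ hdim hreal hconj c hcW hcrat hcH

/-- Weil's question for ONE imaginary quadratic field `K = ℚ(√-d)` (every `n ≥ 2`, every discriminant): the
`d`-slice of `WeilClassesImaginaryQuadratic`. -/
def WeilClassesImaginaryQuadraticAt (d : ℕ) : Prop :=
  ∀ (n : ℕ), 2 ≤ n → ∀ (A : Motives.AbelianVariety ℂ) (φ : A ⟶ A), A.dim = 2 * n →
    Motives.IsSmoothProjective (2 * n) A.X → φ ≫ φ = -(d • 𝟙 A) →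
      ∀ c : complexBetti A.X (2 * n), IsRationalClass c →
        IsOfHodgeType (2 * n) A.X (2 * n) n n c → c ∈ weilClassesOf A φ n d →
          c ∈ algebraicClasses A.X n

/-- LEMMA BC at a FIXED pair `(d, P)`: the base change to the one field `E = ℚ[T]/(P) ⊃ ℚ(√-d)` serves every
`ℚ(√-d)`-Weil datum of every dimension (intended `P = P_{d,a}` for one non-square `a > 0`). -/
def WeilBaseChangeRestrictionAt (d : ℕ) (P : Polynomial ℤ) : Prop :=
  ∀ (n : ℕ), 1 ≤ n → ∀ (A : AbelianVariety ℂ) (φ : A ⟶ A), A.dim = 2 * n → φ ≫ φ = -(d • 𝟙 A) →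
    ∃ (B : AbelianVariety ℂ) (θ : B ⟶ B) (i : A.X ⟶ B.X),
      Polynomial.eval₂ (Int.castRingHom (CategoryTheory.End B)) (θ : CategoryTheory.End B) P = 0 ∧
      B.dim = 4 * n ∧
      ∀ c : complexBetti A.X (2 * n), IsRationalClass c → IsOfHodgeType (2 * n) A.X (2 * n) n n c →
        c ∈ weilClassesOf A φ n d →
        ∃ c' : complexBetti B.X (2 * n), c' ∈ weilClassesField B θ P (2 * n) ∧ IsRationalClass c' ∧
          IsOfHodgeType B.dim B.X (2 * n) n n c' ∧ complexBetti.map i (2 * n) c' = c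

/-- R∞ (`WeilClassesImaginaryQuadratic`) is the conjunction of its `d`-slices. -/
theorem weilClassesImaginaryQuadratic_iff_forall_at :
    WeilClassesImaginaryQuadratic ↔ ∀ d : ℕ, 0 < d → WeilClassesImaginaryQuadraticAt d := by
  constructor
  · intro h d hd n hn A φ hA hAsp hφ c hc hH hcW
    exact h n hn d hd A φ hA hAsp hφ c hc hH hcW
  · intro h n hn d hd A φ hA hAsp hφ c hc hH hcW
    exact h d hd n hn A φ hA hAsp hφ c hc hH hcW

/-- **`P_{d,a}` is a CM quartic** for every `d ≥ 1` and every non-square `a` (part BCA-a). -/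
theorem isCMQuartic_bcQuarticAlong (d a : ℕ) (hd : 0 < d) (ha : ¬ IsSquare a) :
    IsCMQuartic (bcQuarticAlong d a) :=
  ⟨bcQuarticAlong_monic d a, bcQuarticAlong_natDegree d a, bcQuarticAlong_irreducible d a hd ha,
    fun _ hρ => conj_ne_self_of_bcQuarticAlong d a hd (pos_of_not_isSquare ha) hρ,
    exists_conjPolynomial_bcQuarticAlong d a hd⟩

/-- **LEMMA BC at the fixed pair `(d, P_{d,a})` holds** for every `d ≥ 1` (and, formally, every `a : ℕ`; it is
USED for non-square `a`, where `P_{d,a}` is a CM quartic, `isCMQuartic_bcQuarticAlong`) — witnesses: `B = A × A`,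
`θ = θ_a`, `i = (𝟙, 0)`, `c' = L_r c` for the weights `Σ_m r_m m^j = a^{j/2}[j even]` (`j ≤ 2n`; `Σ r_m = 1`).
One quartic CM field `E = ℚ(√-d, √a)` receives every `ℚ(√-d)`-Weil datum of every dimension and every
discriminant. -/
theorem weilBaseChangeRestrictionAt_bcQuarticAlong {d : ℕ} (a : ℕ) (hd : 0 < d) :
    WeilBaseChangeRestrictionAt d (bcQuarticAlong d a) := by
  intro n _hn A φ hA hφ
  classical
  obtain ⟨r, hr⟩ := exists_rat_weights (2 * n + 1) (evenPowWeightAlong a)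
  refine ⟨A.prod A, bcThetaAlong a φ, (bcIncl A).hom.hom.hom, eval₂_bcThetaAlong_bcQuarticAlong a φ hφ,
    by rw [AbelianVariety.dim_prod, hA]; ring, fun c hcrat hcH hcW => ?_⟩
  refine ⟨bcLift A r (2 * n) c, bcLift_mem_weilClassesField_along a φ hA hd hφ hr hcW,
    isRationalClass_bcLift r _ hcrat, isOfHodgeType_bcLift r (isSmoothProjective_of_dim_eq' hA) hcH, ?_⟩
  rw [map_bcIncl_bcLift]
  have h1 : (∑ m : Fin (2 * n + 1), ((r m : ℚ) : ℂ)) = 1 := by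
    have h := hr 0 (Nat.succ_pos _)
    simp only [pow_zero, mul_one, evenPowWeightAlong_zero] at h
    exact_mod_cast h
  rw [h1, one_smul]

end Statement

/-! ### §5 Pay-offs: R3 at ONE quartic ⟹ Weil's question for `ℚ(√-d)`; cyclotomic placements -/

section Payoff

/-- **One quartic CM field per imaginary quadratic field (memo §2.2).** Granted LEMMA BC at `(d, P)`, the slice of
R3 at the single quartic `P` implies Weil's question for `ℚ(√-d)` in every dimension `2n ≥ 4` and every
discriminant: lift, apply the slice on `B`, restrict along `i` (pull-back of algebraic classes between abelian
varieties, `map_mem_algebraicClasses_of_abelianVariety` — no Fulton binder). -/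
theorem weilClassesImaginaryQuadraticAt_of_weilClassesCMFieldAt {d : ℕ} {P : Polynomial ℤ}
    (hBC : WeilBaseChangeRestrictionAt d P) (h₃ : WeilClassesCMFieldAt P) :
    WeilClassesImaginaryQuadraticAt d := by
  intro n hn A φ hA hAsp hφ c hc hH hcW
  obtain ⟨B, θ, i, hθ, hB, hres⟩ := hBC n (by omega) A φ hA hφ
  obtain ⟨c', hc'W, hc'rat, hc'H, hc'eq⟩ := hres c hc hH hcW
  have halg : c' ∈ algebraicClasses B.X n := h₃ B θ n hθ (by rw [hB]; ring) c' hc'W hc'rat hc'H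
  rw [← hc'eq]
  exact map_mem_algebraicClasses_of_abelianVariety hAsp B i halg

/-- **Weil's question for `K = ℚ(√-d)` from the Weil classes of the ONE quartic CM field `K(√a)`** (`d ≥ 1`;
meant for non-square `a`, where `WeilClassesCMFieldAt P_{d,a}` is a slice of R3, `weilClassesCMFieldAt_of_weilClassesCMField`
with `isCMQuartic_bcQuarticAlong`): `WeilClassesCMFieldAt P_{d,a} ⟹ WeilClassesImaginaryQuadraticAt d`. -/
theorem weilClassesImaginaryQuadraticAt_of_weilClassesCMFieldAt_along {d : ℕ} (a : ℕ) (hd : 0 < d)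
    (h₃ : WeilClassesCMFieldAt (bcQuarticAlong d a)) : WeilClassesImaginaryQuadraticAt d :=
  weilClassesImaginaryQuadraticAt_of_weilClassesCMFieldAt (weilBaseChangeRestrictionAt_bcQuarticAlong a hd) h₃

/-- **R3 ⟹ R∞ along any fixed non-square `a`** (second proof of gen 139's
`weilClassesImaginaryQuadratic_of_weilClassesCMField`, which used `a = 2`). -/
theorem weilClassesImaginaryQuadratic_of_weilClassesCMField_along {a : ℕ} (ha : ¬ IsSquare a)
    (h₃ : WeilClassesCMField) : WeilClassesImaginaryQuadratic :=
  weilClassesImaginaryQuadratic_iff_forall_at.mpr fun d hd =>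
    weilClassesImaginaryQuadraticAt_of_weilClassesCMFieldAt_along a hd
      (weilClassesCMFieldAt_of_weilClassesCMField (isCMQuartic_bcQuarticAlong d a hd ha) h₃)

/-- `P_{1,3} = T⁴ − 4T² + 16` is a CM quartic (`E = ℚ(ζ₁₂)`; `3` is not a square — `1² < 3 < 2²`, cf. the
tree's `WeierstrassCurve.not_isSquare_three`): its slice `WeilClassesCMFieldAt P_{1,3}` IS an instance of rung R3. -/
theorem isCMQuartic_bcQuarticAlong_one_three : IsCMQuartic (bcQuarticAlong 1 3) :=
  isCMQuartic_bcQuarticAlong 1 3 Nat.one_pos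
    fun ⟨r, hr⟩ => Nat.not_exists_sq (m := 1) (by norm_num) (by norm_num) ⟨r, hr.symm⟩

/-- `P_{3,3} = T⁴ + 36` is a CM quartic (`E = ℚ(ζ₁₂)`). -/
theorem isCMQuartic_bcQuarticAlong_three_three : IsCMQuartic (bcQuarticAlong 3 3) :=
  isCMQuartic_bcQuarticAlong 3 3 (by norm_num)
    fun ⟨r, hr⟩ => Nat.not_exists_sq (m := 1) (by norm_num) (by norm_num) ⟨r, hr.symm⟩

/-- `P_{1,2} = T⁴ − 2T² + 9` is a CM quartic (`E = ℚ(ζ₈)`; `2` is not a square — `1² < 2 < 2²`). -/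
theorem isCMQuartic_bcQuarticAlong_one_two : IsCMQuartic (bcQuarticAlong 1 2) :=
  isCMQuartic_bcQuarticAlong 1 2 Nat.one_pos
    fun ⟨r, hr⟩ => Nat.not_exists_sq (m := 1) (by norm_num) (by norm_num) ⟨r, hr.symm⟩

/-- `P_{2,2} = T⁴ + 16` is a CM quartic (`E = ℚ(ζ₈)`). -/
theorem isCMQuartic_bcQuarticAlong_two_two : IsCMQuartic (bcQuarticAlong 2 2) :=
  isCMQuartic_bcQuarticAlong 2 2 (by norm_num)
    fun ⟨r, hr⟩ => Nat.not_exists_sq (m := 1) (by norm_num) (by norm_num) ⟨r, hr.symm⟩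

/-- `P_{3,3} = T⁴ + 36` (generator `√3 + √-3 = √3(1 + i)` of `ℚ(ζ₁₂)`). -/
theorem bcQuarticAlong_three_three : bcQuarticAlong 3 3 = Polynomial.X ^ 4 + Polynomial.C 36 := by
  unfold bcQuarticAlong; norm_num

/-- `P_{2,2} = T⁴ + 16` (generator `√2 + √-2 = 2ζ₈` of `ℚ(ζ₈)`). -/
theorem bcQuarticAlong_two_two : bcQuarticAlong 2 2 = Polynomial.X ^ 4 + Polynomial.C 16 := by
  unfold bcQuarticAlong; norm_num

/-- **`ℚ(ζ₁₂)` carries Weil's question for `ℚ(i)`**: the slice of R3 at `P_{1,3} = T⁴ − 4T² + 16` (root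
`√3 + i = 2ζ₁₂`, `E = ℚ(i, √3) = ℚ(ζ₁₂)`) implies `WeilClassesImaginaryQuadraticAt 1`. -/
theorem weilClassesImaginaryQuadraticAt_one_of_zeta12 (h₃ : WeilClassesCMFieldAt (bcQuarticAlong 1 3)) :
    WeilClassesImaginaryQuadraticAt 1 :=
  weilClassesImaginaryQuadraticAt_of_weilClassesCMFieldAt_along 3 Nat.one_pos h₃

/-- **`ℚ(ζ₁₂)` carries Weil's question for `ℚ(√-3)`**: the slice of R3 at `P_{3,3} = T⁴ + 36`
(`E = ℚ(√-3, √3) = ℚ(ζ₁₂)`) implies `WeilClassesImaginaryQuadraticAt 3`. -/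
theorem weilClassesImaginaryQuadraticAt_three_of_zeta12 (h₃ : WeilClassesCMFieldAt (bcQuarticAlong 3 3)) :
    WeilClassesImaginaryQuadraticAt 3 :=
  weilClassesImaginaryQuadraticAt_of_weilClassesCMFieldAt_along 3 (by norm_num) h₃

/-- **`ℚ(ζ₈)` carries Weil's question for `ℚ(i)`**: the slice of R3 at `P_{1,2} = P_1 = T⁴ − 2T² + 9`
(`E = ℚ(i, √2) = ℚ(ζ₈)`) implies `WeilClassesImaginaryQuadraticAt 1`. -/
theorem weilClassesImaginaryQuadraticAt_one_of_zeta8 (h₃ : WeilClassesCMFieldAt (bcQuarticAlong 1 2)) :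
    WeilClassesImaginaryQuadraticAt 1 :=
  weilClassesImaginaryQuadraticAt_of_weilClassesCMFieldAt_along 2 Nat.one_pos h₃

/-- **`ℚ(ζ₈)` carries Weil's question for `ℚ(√-2)`**: the slice of R3 at `P_{2,2} = T⁴ + 16`
(`E = ℚ(√-2, √2) = ℚ(ζ₈)`) implies `WeilClassesImaginaryQuadraticAt 2`. -/
theorem weilClassesImaginaryQuadraticAt_two_of_zeta8 (h₃ : WeilClassesCMFieldAt (bcQuarticAlong 2 2)) :
    WeilClassesImaginaryQuadraticAt 2 :=
  weilClassesImaginaryQuadraticAt_of_weilClassesCMFieldAt_along 2 (by norm_num) h₃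

end Payoff

end Summit.HodgeConjecture.HodgeConjecture.Ring2.AbelianAll

end
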